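import Literature.AlgebraicGeometry.Resolution.AlterationsLemma411VertexProjection
import Literature.AlgebraicGeometry.Resolution.BaseChangeOverOpens
import Literature.AlgebraicGeometry.Resolution.AlterationsStrictTransformModel
import Literature.AlgebraicGeometry.Resolution.ResolutionOfCurves
import Mathlib.AlgebraicGeometry.Morphisms.Proper
import HarnessLib

/-!
# De Jong 1996, Lemma 4.11 (ii) c) off the vertex: `f|_{Z'} ≅ pr_p ∘ π|_Z`

Topic: `Literature/AlgebraicGeometry/Resolution`. A PROVED layer for the open leaf
`DeJong1996Lemma411VertexChoice` (`AlterationsLemma411Vertex.lean`), formalising the sentence of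
the printed proof of de Jong 1996, Lemma 4.11 (p. 68)

> "Assertion (ii) c) is clear as `Z' ≅ Z → π(Z) → ℙ^{d-1}` is generically étale by construction."

in the normalisation at the vertex `p = (0 : … : 0 : 1) ∈ ℙ^{d+1}_k` used by that leaf. Let
`π : X → ℙ^{d+1}` with `p ∉ π(Z)`, let `b : P̃ → ℙ^{d+1}` be a blowing up in `p` and `q : P̃ → ℙ^d`
the projection from `p` through `b` (`DeJong1996.IsVertexProjection`), and put
`X' = X ×_{ℙ^{d+1}} P̃`, `φ = pr₁`, `f = pr₂ ≫ q`, `Z' = φ⁻¹(Z)`. Then: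

* `DeJong1996.isAffineHom_vertexProjection` — **the linear projection from the vertex
  `pr_p : ℙ^{d+1} ∖ {p} → ℙ^d` (`DeJong1996.vertexProjection`) is an AFFINE morphism**
  (`pr⁻¹ D₊(y_j) = D₊(x_j)`, `vertexProjection_preimage_basicOpen`, and the `D₊(y_j)` cover), whence
  `DeJong1996.isFinite_comp_vertexProjection`: **for `g : T → ℙ^{d+1} ∖ {p}` affine (a closed
  immersion; a finite morphism) with `T` proper over `k`, `T → ℙ^d` is FINITE** (proper + affine;
  `ℙ^d → Spec k` is separated) — classically "projection from a point not on `W` is a finite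
  morphism `W → ℙ^d`", the step of Noether normalisation in projective form behind de Jong's
  2.11 (α) (Görtz–Wedhorn I, proof of Thm. 13.89); `pr_p` itself is not finite (its fibres are
  punctured lines);
* `DeJong1996.offVertex π = X° = π⁻¹(ℙ^{d+1} ∖ {p})`, an open of `X` containing `Z`, and
  `DeJong1996.offVertexProjection π : X° → ℙ^d`, the composite `pr_p ∘ π`;
* `DeJong1996.isIso_fst_morphismRestrict_offVertex` — **`φ` is an isomorphism over `X°`** (the
  blowing up `b` is an isomorphism off its centre, `IsBlowup.isIso_morphismRestrict`, and `φ` is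
  its base change);
* `DeJong1996.preimage_offVertex_ι_comp` — **on `φ⁻¹(X°)`, `f = pr_p ∘ π ∘ φ`**
  (`IsVertexProjection` in global form);
* `DeJong1996.reducedProjection` — the map `Z_red → X° → ℙ^d`, i.e. `pr_p ∘ π|_Z` on the
  reduced closed subscheme `Z_red` (2.2), FINITE as soon as `π` is affine (e.g. finite) and `X`
  is proper over `k` (`isFinite_reducedProjection`: proper + affine, `VertexProjectionAffine`);
* `DeJong1996.reducedPreimageIso` — **`Z'_red ≅ Z_red` over `X° ≅ φ⁻¹(X°)`**, whence
  `DeJong1996.vanishingIdeal_subschemeι_comp_fibration`: `Z'_red → X' → ℙ^d` is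
  `Z'_red ≅ Z_red → ℙ^d`;
* **`DeJong1996.isFiniteGenericallyEtaleOn_fibration_of_isGenericallyEtale`** — conclusion
  (ii) c) of Lemma 4.11, `IsFiniteGenericallyEtaleOn f Z'`, FOLLOWS from generic étaleness of
  `pr_p ∘ π|_Z : Z_red → ℙ^d` alone (finiteness being automatic); and the same keyed to the
  hypothesis structures of the leaf (`…_of_lemma411Projection`).

What is left to the choice of `π` for (ii) c) is thus exactly "`Z → π(Z) → ℙ^{d-1}` is generically
étale by construction". No named fact is introduced; everything is [folklore] plumbing around
the two cited sentences and PROVED.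

## Sources

* A. J. de Jong, *Smoothness, semi-stability and alterations*, Publ. Math. IHÉS 83 (1996),
  proof of Lemma 4.11, p. 68. [DeJong1996]
* U. Görtz, T. Wedhorn, *Algebraic Geometry I: Schemes*, 2nd ed. (2020): Prop. 13.91 (3)
  (a blow-up is an isomorphism off its centre); Thm. 13.89 (proof: projection from a point
  outside is finite); Cor. 12.89 (finite = proper + affine). [GortzWedhorn2020]
-/

noncomputable section

open CategoryTheory CategoryTheory.Limits AlgebraicGeometry TopologicalSpace HomogeneousLocalization

attribute [local instance] MvPolynomial.gradedAlgebra

namespace Literature.AlgebraicGeometry.Resolution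

universe u

open Literature.AlgebraicGeometry.Motives (projectiveSpace)
open Literature.AlgebraicGeometry.Motives.Segre (grading chartι toSpec X_mem irrelevant_le_span_X)
open Scheme.IdealSheafData

namespace DeJong1996

variable (d : ℕ) (k : Type u) [Field k]

/-! ## The projection from the vertex is affine -/

/-- The open `D₊(x_j) ∖ {vertex}` of the punctured space — which is all of `D₊(x_j)`, `j ≤ d`,
the vertex lying outside `D₊(x_j)` — is affine. [folklore] -/
theorem isAffineOpen_ι_preimage_basicOpen (j : Fin (d + 1)) :
    IsAffineOpen ((puncturedSpace d k).ι ⁻¹ᵁ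
      Proj.basicOpen (grading (Fin (d + 1 + 1)) k) (MvPolynomial.X (Fin.castSucc j))) := by
  refine (Proj.isAffineOpen_basicOpen _ _ (X_mem k (Fin.castSucc j)) zero_lt_one)
    |>.preimage_of_isOpenImmersion (puncturedSpace d k).ι ?_
  rw [Scheme.Opens.opensRange_ι]
  exact basicOpen_le_puncturedSpace d k j

/-- `pr⁻¹ D₊(y_j)` is affine (it is `D₊(x_j) ∖ {vertex} = D₊(x_j)`). [folklore] -/
theorem isAffineOpen_vertexProjection_preimage_basicOpen (j : Fin (d + 1)) :
    IsAffineOpen (vertexProjection d k ⁻¹ᵁ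
      Proj.basicOpen (grading (Fin (d + 1)) k) (MvPolynomial.X j)) := by
  rw [vertexProjection_preimage_basicOpen]
  exact isAffineOpen_ι_preimage_basicOpen d k j

/-- The standard charts `D₊(y_j)` cover `ℙ^d`: every point lies in one of them. [folklore] -/
theorem exists_mem_basicOpen (y : Proj (grading (Fin (d + 1)) k)) :
    ∃ j : Fin (d + 1), y ∈ Proj.basicOpen (grading (Fin (d + 1)) k) (MvPolynomial.X j) := by
  have h : y ∈ (⨆ j : Fin (d + 1), Proj.basicOpen (grading (Fin (d + 1)) k) (MvPolynomial.X j)) := by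
    rw [Proj.iSup_basicOpen_eq_top (grading (Fin (d + 1)) k)
      (fun j : Fin (d + 1) => (MvPolynomial.X j : MvPolynomial (Fin (d + 1)) k))
      (irrelevant_le_span_X (Fin (d + 1)) k)]
    trivial
  exact Opens.mem_iSup.1 h

/-- **The linear projection from the vertex `pr : ℙ^{d+1} ∖ {vertex} → ℙ^d` is an affine
morphism**: the preimages `pr⁻¹ D₊(y_j) = D₊(x_j)` of the standard affine charts, which cover
`ℙ^d`, are affine. [folklore] -/
theorem isAffineHom_vertexProjection : IsAffineHom (vertexProjection d k) := by
  refine isAffineHom_of_forall_exists_isAffineOpen _ fun y => ?_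
  obtain ⟨j, hj⟩ := exists_mem_basicOpen d k y
  exact ⟨_, hj, Proj.isAffineOpen_basicOpen _ _ (X_mem k j) zero_lt_one,
    isAffineOpen_vertexProjection_preimage_basicOpen d k j⟩

/-! ## Finiteness of the projection on proper subschemes missing the vertex -/

/-- The structure morphism `ℙ^d_k → Spec k` is separated. [folklore] -/
theorem isSeparated_toSpec (n : ℕ) : IsSeparated (toSpec (Fin (n + 1)) k) := by
  unfold Literature.AlgebraicGeometry.Motives.Segre.toSpec
  infer_instance

/-- **A `k`-morphism into `ℙ^{d+1} ∖ {vertex}` from a proper `k`-scheme, followed by the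
projection from the vertex, is proper** (`ℙ^d → Spec k` is separated). Here "over `k`" is
built in: the structure morphism of `T` is taken to be `g` followed by that of the punctured
space. [folklore] -/
theorem isProper_comp_vertexProjection {T : Scheme.{u}} (g : T ⟶ (puncturedSpace d k : Scheme.{u}))
    [IsProper (g ≫ (puncturedSpace d k).ι ≫ toSpec (Fin (d + 1 + 1)) k)] :
    IsProper (g ≫ vertexProjection d k) := by
  have h : IsProper ((g ≫ vertexProjection d k) ≫ toSpec (Fin (d + 1)) k) := by
    rw [Category.assoc, vertexProjection_toSpec]
    infer_instance
  haveI := isSeparated_toSpec k d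
  exact IsProper.of_comp (g ≫ vertexProjection d k) (toSpec (Fin (d + 1)) k)

/-- **Projection from a point not on `W` is finite on `W`** (de Jong 2.11 (α); Görtz–Wedhorn I,
proof of Thm. 13.89), in relative form: for an AFFINE morphism `g : T → ℙ^{d+1} ∖ {vertex}`
(a closed immersion `W ↪ ℙ^{d+1}` missing the vertex; or `Z_red ↪ X` followed by a finite
`π : X → ℙ^{d+1}` with `vertex ∉ π(Z)`, as in the proof of Lemma 4.11) from a proper `k`-scheme
`T`, the composite `T → ℙ^d` with the projection from the vertex is FINITE — it is affine
(`isAffineHom_vertexProjection`) and proper (`isProper_comp_vertexProjection`).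
[cite: GortzWedhorn2020, Thm. 13.89 (proof) and Cor. 12.89] -/
theorem isFinite_comp_vertexProjection {T : Scheme.{u}}
    (g : T ⟶ (puncturedSpace d k : Scheme.{u})) [IsAffineHom g]
    [IsProper (g ≫ (puncturedSpace d k).ι ≫ toSpec (Fin (d + 1 + 1)) k)] :
    IsFinite (g ≫ vertexProjection d k) :=
  haveI := isAffineHom_vertexProjection d k
  IsFinite.iff_isProper_and_isAffineHom.2
    ⟨isProper_comp_vertexProjection d k g, inferInstance⟩


/-! ## The open `X° = π⁻¹(ℙ^{d+1} ∖ {vertex})` and the projection `pr ∘ π` on it -/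

section OffVertex

variable {X : Scheme.{u}} (π : X ⟶ Proj (grading (Fin (d + 1 + 1)) k))

/-- `X° = π⁻¹(ℙ^{d+1} ∖ {vertex})`, the open of `X` over which the base change of the blowing
up in the vertex is an isomorphism. [folklore] -/
abbrev offVertex : X.Opens := π ⁻¹ᵁ puncturedSpace d k

/-- `x ∈ X°` iff `π(x)` is not the vertex. [folklore] -/
theorem mem_offVertex_iff (x : X) : x ∈ offVertex d k π ↔ π x ≠ vertex d k := by
  rw [← mem_puncturedSpace_iff]
  rfl

/-- A subset `Z ⊆ X` with `vertex ∉ π(Z)` lies in `X°`. [folklore] -/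
theorem subset_offVertex {Z : Set X} (hZ : vertex d k ∉ π '' Z) : Z ⊆ (offVertex d k π : Set X) :=
  fun x hx => (mem_offVertex_iff d k π x).2 fun h => hZ ⟨x, hx, h⟩

/-- **`pr ∘ π : X° → ℙ^d`**, the projection from the vertex after `π`, on the open where it is
defined. [folklore] -/
def offVertexProjection : (offVertex d k π : Scheme.{u}) ⟶ Proj (grading (Fin (d + 1)) k) :=
  (π ∣_ puncturedSpace d k) ≫ vertexProjection d k

/-- `pr ∘ π` is a morphism over `k`. [folklore] -/
theorem offVertexProjection_toSpec :
    offVertexProjection d k π ≫ toSpec (Fin (d + 1)) k =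
      (offVertex d k π).ι ≫ π ≫ toSpec (Fin (d + 1 + 1)) k := by
  rw [offVertexProjection, Category.assoc, vertexProjection_toSpec, morphismRestrict_ι_assoc]

end OffVertex

/-! ## `φ` is an isomorphism over `X°`, and `f = pr ∘ π ∘ φ` there -/

section Fibration

variable {X : Scheme.{u}} (π : X ⟶ Proj (grading (Fin (d + 1 + 1)) k)) {P : Scheme.{u}}
  {b : P ⟶ Proj (grading (Fin (d + 1 + 1)) k)} {q : P ⟶ Proj (grading (Fin (d + 1)) k)}

/-- The punctured space misses the support `{vertex}` of the centre of the blowing up.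
[folklore] -/
theorem disjoint_puncturedSpace_support
    (h : IsClosed ({vertex d k} : Set (Proj (grading (Fin (d + 1 + 1)) k)))) :
    Disjoint (puncturedSpace d k : Set (Proj (grading (Fin (d + 1 + 1)) k)))
      ((vanishingIdeal ⟨{vertex d k}, h⟩).support : Set (Proj (grading (Fin (d + 1 + 1)) k))) := by
  rw [coe_support_vanishingIdeal, coe_puncturedSpace]
  exact disjoint_compl_left

/-- **A blowing up of `ℙ^{d+1}` in the vertex is an isomorphism over `ℙ^{d+1} ∖ {vertex}`**
(Görtz–Wedhorn I, Prop. 13.91 (3)). [cite: GortzWedhorn2020, Prop. 13.91 (3)] -/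
theorem isIso_morphismRestrict_puncturedSpace_of_isBlowup
    {h : IsClosed ({vertex d k} : Set (Proj (grading (Fin (d + 1 + 1)) k)))}
    (hb : IsBlowup b (vanishingIdeal ⟨{vertex d k}, h⟩)) : IsIso (b ∣_ puncturedSpace d k) :=
  hb.isIso_morphismRestrict (disjoint_puncturedSpace_support d k h)

/-- **`φ = pr₁ : X ×_{ℙ^{d+1}} P̃ → X` is an isomorphism over `X° = π⁻¹(ℙ^{d+1} ∖ {vertex})`**
(base change of the previous statement). [folklore] -/
theorem isIso_fst_morphismRestrict_offVertex
    {h : IsClosed ({vertex d k} : Set (Proj (grading (Fin (d + 1 + 1)) k)))}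
    (hb : IsBlowup b (vanishingIdeal ⟨{vertex d k}, h⟩)) :
    IsIso (pullback.fst π b ∣_ offVertex d k π) :=
  haveI := isIso_morphismRestrict_puncturedSpace_of_isBlowup d k hb
  morphismRestrict_pullback_fst_of_morphismRestrict (P := MorphismProperty.isomorphisms Scheme.{u})
    π b (puncturedSpace d k) (show IsIso _ from inferInstance)

/-- The lift of `pr₂` on `φ⁻¹(X°)` to `b⁻¹(ℙ^{d+1} ∖ {vertex})`. [folklore] -/
def sndOffVertex :
    (↑(pullback.fst π b ⁻¹ᵁ offVertex d k π) : Scheme.{u}) ⟶ ↑(b ⁻¹ᵁ puncturedSpace d k) :=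
  IsOpenImmersion.lift (b ⁻¹ᵁ puncturedSpace d k).ι
    ((pullback.fst π b ⁻¹ᵁ offVertex d k π).ι ≫ pullback.snd π b) (by
      rintro _ ⟨x, rfl⟩
      rw [Scheme.Opens.range_ι]
      change b (pullback.snd π b ((pullback.fst π b ⁻¹ᵁ offVertex d k π).ι x)) ∈ puncturedSpace d k
      rw [← Scheme.Hom.comp_apply (pullback.snd π b) b, ← pullback.condition, Scheme.Hom.comp_apply]
      exact x.2)

/-- `sndOffVertex` followed by the inclusion is `pr₂` on `φ⁻¹(X°)`. [folklore] -/
@[reassoc]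
theorem sndOffVertex_ι :
    sndOffVertex d k π ≫ (b ⁻¹ᵁ puncturedSpace d k).ι =
      (pullback.fst π b ⁻¹ᵁ offVertex d k π).ι ≫ pullback.snd π b :=
  IsOpenImmersion.lift_fac _ _ _

/-- `sndOffVertex` followed by `b|` is `φ|` followed by `π|`. [folklore] -/
@[reassoc]
theorem sndOffVertex_morphismRestrict :
    sndOffVertex d k π ≫ (b ∣_ puncturedSpace d k) =
      (pullback.fst π b ∣_ offVertex d k π) ≫ (π ∣_ puncturedSpace d k) := by
  rw [← cancel_mono (puncturedSpace d k).ι]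
  simp only [Category.assoc, morphismRestrict_ι]
  rw [sndOffVertex_ι_assoc, ← pullback.condition]
  conv_rhs => rw [← Category.assoc, morphismRestrict_ι, Category.assoc]

/-- **Off the exceptional locus `f = pr₂ ≫ q` is `pr ∘ π ∘ φ`**: on `φ⁻¹(X°)`,
`f = φ| ≫ (pr ∘ π)` (de Jong: "`Z' ≅ Z → π(Z) → ℙ^{d-1}`"; `IsVertexProjection` in its global
form `q|_{b⁻¹(ℙ ∖ vertex)} = pr ∘ b|`). [cite: DeJong1996, Lemma 4.11 (proof), p. 68] -/
theorem preimage_offVertex_ι_comp (hV : IsVertexProjection d k b q) :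
    (pullback.fst π b ⁻¹ᵁ offVertex d k π).ι ≫ pullback.snd π b ≫ q =
      (pullback.fst π b ∣_ offVertex d k π) ≫ offVertexProjection d k π := by
  rw [← sndOffVertex_ι_assoc, hV.preimage_ι_comp d k, sndOffVertex_morphismRestrict_assoc]
  rfl

end Fibration

/-! ## `Z_red → X° → ℙ^d` -/

section Reduced

variable {X : Scheme.{u}} (π : X ⟶ Proj (grading (Fin (d + 1 + 1)) k)) {Z : Set X}
  (hZ : IsClosed Z) (hπZ : vertex d k ∉ π '' Z)

/-- The reduced closed subscheme `Z_red` (2.2) mapped into `X°` (possible as `vertex ∉ π(Z)`).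
[folklore] -/
def reducedToOffVertex : ((vanishingIdeal ⟨Z, hZ⟩).subscheme : Scheme.{u}) ⟶ ↑(offVertex d k π) :=
  IsOpenImmersion.lift (offVertex d k π).ι (vanishingIdeal ⟨Z, hZ⟩).subschemeι (by
    rw [Scheme.Opens.range_ι, range_subschemeι_vanishingIdeal]
    exact subset_offVertex d k π hπZ)

/-- `Z_red → X° ⊆ X` is the inclusion of `Z_red`. [folklore] -/
@[reassoc (attr := simp)]
theorem reducedToOffVertex_ι :
    reducedToOffVertex d k π hZ hπZ ≫ (offVertex d k π).ι = (vanishingIdeal ⟨Z, hZ⟩).subschemeι :=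
  IsOpenImmersion.lift_fac _ _ _

/-- `Z_red → X°` is a closed immersion. [folklore] -/
instance isClosedImmersion_reducedToOffVertex :
    IsClosedImmersion (reducedToOffVertex d k π hZ hπZ) := by
  have : IsClosedImmersion (reducedToOffVertex d k π hZ hπZ ≫ (offVertex d k π).ι) := by
    rw [reducedToOffVertex_ι]
    infer_instance
  exact IsClosedImmersion.of_comp _ (offVertex d k π).ι

/-- **`pr ∘ π|_Z : Z_red → ℙ^d`** — the map of (ii) c) read on `X` ("`Z → π(Z) → ℙ^{d-1}`").
[cite: DeJong1996, Lemma 4.11 (proof), p. 68] -/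
def reducedProjection : ((vanishingIdeal ⟨Z, hZ⟩).subscheme : Scheme.{u}) ⟶ Proj (grading (Fin (d + 1)) k) :=
  reducedToOffVertex d k π hZ hπZ ≫ offVertexProjection d k π

/-- Unfolding `reducedProjection`. [folklore] -/
theorem reducedProjection_eq :
    reducedProjection d k π hZ hπZ =
      (reducedToOffVertex d k π hZ hπZ ≫ (π ∣_ puncturedSpace d k)) ≫ vertexProjection d k := by
  rw [reducedProjection, offVertexProjection, Category.assoc]

/-- `Z_red → X° → ℙ^{d+1} ∖ {vertex}` is an affine morphism when `π` is (it is `Z_red ↪ X → ℙ^{d+1}`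
corestricted along an open immersion). [folklore] -/
theorem isAffineHom_reducedToOffVertex_comp [IsAffineHom π] :
    IsAffineHom (reducedToOffVertex d k π hZ hπZ ≫ (π ∣_ puncturedSpace d k)) := by
  have h : (reducedToOffVertex d k π hZ hπZ ≫ (π ∣_ puncturedSpace d k)) ≫ (puncturedSpace d k).ι =
      (vanishingIdeal ⟨Z, hZ⟩).subschemeι ≫ π := by
    rw [Category.assoc, morphismRestrict_ι, ← reducedToOffVertex_ι d k π hZ hπZ, Category.assoc]
  have : IsAffineHom ((reducedToOffVertex d k π hZ hπZ ≫ (π ∣_ puncturedSpace d k)) ≫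
      (puncturedSpace d k).ι) := by
    rw [h]
    infer_instance
  exact MorphismProperty.of_postcomp (W := @IsAffineHom) (W' := @IsSeparated) _
    (puncturedSpace d k).ι inferInstance this

/-- **`pr ∘ π|_Z : Z_red → ℙ^d` is finite** when `π` is affine (e.g. finite) and `X` is proper
over `k` through `π`: it is affine, and proper as a `k`-morphism out of the proper `Z_red`
(`isFinite_comp_vertexProjection`). [cite: DeJong1996, Lemma 4.11 (proof), p. 68] -/
theorem isFinite_reducedProjection [IsAffineHom π] [IsProper (π ≫ toSpec (Fin (d + 1 + 1)) k)] :
    IsFinite (reducedProjection d k π hZ hπZ) := by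
  haveI := isAffineHom_reducedToOffVertex_comp d k π hZ hπZ
  have h : (reducedToOffVertex d k π hZ hπZ ≫ (π ∣_ puncturedSpace d k)) ≫ (puncturedSpace d k).ι ≫
      toSpec (Fin (d + 1 + 1)) k = (vanishingIdeal ⟨Z, hZ⟩).subschemeι ≫ π ≫ toSpec (Fin (d + 1 + 1)) k := by
    rw [Category.assoc, morphismRestrict_ι_assoc, ← reducedToOffVertex_ι d k π hZ hπZ, Category.assoc]
  haveI : IsProper ((reducedToOffVertex d k π hZ hπZ ≫ (π ∣_ puncturedSpace d k)) ≫
      (puncturedSpace d k).ι ≫ toSpec (Fin (d + 1 + 1)) k) := by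
    rw [h]
    infer_instance
  rw [reducedProjection_eq]
  exact isFinite_comp_vertexProjection d k _

end Reduced

/-! ## `Z'_red ≅ Z_red` and (ii) c) -/

section StrictPreimage

variable {X : Scheme.{u}} (π : X ⟶ Proj (grading (Fin (d + 1 + 1)) k)) {Z : Set X}
  {P : Scheme.{u}}

/-- `Z' = φ⁻¹(Z)` is closed. [folklore] -/
theorem isClosed_preimage_fst (hZ : IsClosed Z) (b : P ⟶ Proj (grading (Fin (d + 1 + 1)) k)) :
    IsClosed ((pullback.fst π b) ⁻¹' Z) :=
  hZ.preimage (pullback.fst π b).continuous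

/-- `Z' = φ⁻¹(Z) ⊆ φ⁻¹(X°)`. [folklore] -/
theorem preimage_subset_preimage_offVertex (hπZ : vertex d k ∉ π '' Z)
    (b : P ⟶ Proj (grading (Fin (d + 1 + 1)) k)) :
    (pullback.fst π b) ⁻¹' Z ⊆ ((pullback.fst π b ⁻¹ᵁ offVertex d k π : (pullback π b).Opens) :
      Set ↑(pullback π b)) :=
  fun _ hx => subset_offVertex d k π hπZ hx

variable (hZ : IsClosed Z) (hπZ : vertex d k ∉ π '' Z) (b : P ⟶ Proj (grading (Fin (d + 1 + 1)) k))

/-- `Z'_red → φ⁻¹(X°)`. [folklore] -/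
def reducedPreimageToOffVertex :
    ((vanishingIdeal ⟨(pullback.fst π b) ⁻¹' Z, isClosed_preimage_fst d k π hZ b⟩).subscheme :
      Scheme.{u}) ⟶ ↑(pullback.fst π b ⁻¹ᵁ offVertex d k π) :=
  IsOpenImmersion.lift (pullback.fst π b ⁻¹ᵁ offVertex d k π).ι
    (vanishingIdeal ⟨(pullback.fst π b) ⁻¹' Z, isClosed_preimage_fst d k π hZ b⟩).subschemeι (by
    rw [Scheme.Opens.range_ι, range_subschemeι_vanishingIdeal]
    exact preimage_subset_preimage_offVertex d k π hπZ b)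

/-- `Z'_red → φ⁻¹(X°) ⊆ X'` is the inclusion of `Z'_red`. [folklore] -/
@[reassoc (attr := simp)]
theorem reducedPreimageToOffVertex_ι :
    reducedPreimageToOffVertex d k π hZ hπZ b ≫ (pullback.fst π b ⁻¹ᵁ offVertex d k π).ι =
      (vanishingIdeal ⟨(pullback.fst π b) ⁻¹' Z, isClosed_preimage_fst d k π hZ b⟩).subschemeι :=
  IsOpenImmersion.lift_fac _ _ _

/-- `Z'_red → φ⁻¹(X°)` is a closed immersion. [folklore] -/
instance isClosedImmersion_reducedPreimageToOffVertex :
    IsClosedImmersion (reducedPreimageToOffVertex d k π hZ hπZ b) := by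
  have : IsClosedImmersion (reducedPreimageToOffVertex d k π hZ hπZ b ≫
      (pullback.fst π b ⁻¹ᵁ offVertex d k π).ι) := by
    rw [reducedPreimageToOffVertex_ι]
    infer_instance
  exact IsClosedImmersion.of_comp _ (pullback.fst π b ⁻¹ᵁ offVertex d k π).ι

/-- `Z'_red` is reduced. [folklore] -/
instance isReduced_reducedPreimage :
    IsReduced ((vanishingIdeal ⟨(pullback.fst π b) ⁻¹' Z, isClosed_preimage_fst d k π hZ b⟩).subscheme :
      Scheme.{u}) :=
  isReduced_subscheme_vanishingIdeal _

/-- `Z_red` is reduced. [folklore] -/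
instance isReduced_reduced : IsReduced ((vanishingIdeal ⟨Z, hZ⟩).subscheme : Scheme.{u}) :=
  isReduced_subscheme_vanishingIdeal _

/-- The range of `Z'_red → φ⁻¹(X°) → X°` lies in the range of `Z_red → X°`. [folklore] -/
theorem range_reducedPreimageToOffVertex_comp_subset :
    Set.range (reducedPreimageToOffVertex d k π hZ hπZ b ≫ (pullback.fst π b ∣_ offVertex d k π)) ⊆
      Set.range (reducedToOffVertex d k π hZ hπZ) := by
  rintro _ ⟨w, rfl⟩
  have hw : (offVertex d k π).ι ((reducedPreimageToOffVertex d k π hZ hπZ b ≫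
      (pullback.fst π b ∣_ offVertex d k π)) w) ∈ Z := by
    rw [← Scheme.Hom.comp_apply, Category.assoc, morphismRestrict_ι,
      reducedPreimageToOffVertex_ι_assoc, Scheme.Hom.comp_apply]
    exact mem_of_subscheme_vanishingIdeal
      (⟨(pullback.fst π b) ⁻¹' Z, isClosed_preimage_fst d k π hZ b⟩ : Closeds _) w
  obtain ⟨t, ht⟩ : (offVertex d k π).ι ((reducedPreimageToOffVertex d k π hZ hπZ b ≫
      (pullback.fst π b ∣_ offVertex d k π)) w) ∈ Set.range (vanishingIdeal ⟨Z, hZ⟩).subschemeι := by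
    rw [range_subschemeι_vanishingIdeal]
    exact hw
  refine ⟨t, (offVertex d k π).ι.injective ?_⟩
  rw [← Scheme.Hom.comp_apply, reducedToOffVertex_ι, ht]

/-- **The comparison `Z'_red → Z_red`** over `φ| : φ⁻¹(X°) → X°` (lifting through the closed
immersion `Z_red → X°` from the reduced `Z'_red`). [folklore] -/
def reducedPreimageComparison :
    ((vanishingIdeal ⟨(pullback.fst π b) ⁻¹' Z, isClosed_preimage_fst d k π hZ b⟩).subscheme :
      Scheme.{u}) ⟶ (vanishingIdeal ⟨Z, hZ⟩).subscheme :=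
  IsClosedImmersion.liftOfRange (reducedToOffVertex d k π hZ hπZ)
    (reducedPreimageToOffVertex d k π hZ hπZ b ≫ (pullback.fst π b ∣_ offVertex d k π))
    (range_reducedPreimageToOffVertex_comp_subset d k π hZ hπZ b)

/-- The comparison commutes with the maps to `X°`. [folklore] -/
@[reassoc (attr := simp)]
theorem reducedPreimageComparison_fac :
    reducedPreimageComparison d k π hZ hπZ b ≫ reducedToOffVertex d k π hZ hπZ =
      reducedPreimageToOffVertex d k π hZ hπZ b ≫ (pullback.fst π b ∣_ offVertex d k π) :=
  IsClosedImmersion.liftOfRange_fac _ _ _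

variable {b}

/-- The comparison `Z'_red → Z_red` is a closed immersion when `φ` is an isomorphism over `X°`.
[folklore] -/
theorem isClosedImmersion_reducedPreimageComparison
    [IsIso (pullback.fst π b ∣_ offVertex d k π)] :
    IsClosedImmersion (reducedPreimageComparison d k π hZ hπZ b) := by
  have : IsClosedImmersion (reducedPreimageComparison d k π hZ hπZ b ≫
      reducedToOffVertex d k π hZ hπZ) := by
    rw [reducedPreimageComparison_fac]
    infer_instance
  exact IsClosedImmersion.of_comp _ (reducedToOffVertex d k π hZ hπZ)

/-- The comparison `Z'_red → Z_red` is surjective when `φ` is an isomorphism over `X°`: a point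
`t` of `Z_red` is hit by the point of `Z'` over it. [folklore] -/
theorem surjective_reducedPreimageComparison
    [IsIso (pullback.fst π b ∣_ offVertex d k π)] :
    Surjective (reducedPreimageComparison d k π hZ hπZ b) := by
  refine ⟨fun t => ?_⟩
  set φU := pullback.fst π b ∣_ offVertex d k π with hφU
  -- the point of `φ⁻¹(X°)` over `t`
  set x' : ↥(pullback.fst π b ⁻¹ᵁ offVertex d k π) := (inv φU) (reducedToOffVertex d k π hZ hπZ t)
    with hx'
  have hx'φ : φU x' = reducedToOffVertex d k π hZ hπZ t := by
    rw [hx', ← Scheme.Hom.comp_apply, IsIso.inv_hom_id]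
    rfl
  -- it lies on `Z'`
  have hx'Z : ((pullback.fst π b ⁻¹ᵁ offVertex d k π).ι x') ∈ (pullback.fst π b) ⁻¹' Z := by
    show pullback.fst π b ((pullback.fst π b ⁻¹ᵁ offVertex d k π).ι x') ∈ Z
    rw [← Scheme.Hom.comp_apply, ← morphismRestrict_ι, Scheme.Hom.comp_apply, hx'φ,
      ← Scheme.Hom.comp_apply, reducedToOffVertex_ι]
    exact mem_of_subscheme_vanishingIdeal (⟨Z, hZ⟩ : Closeds X) t
  obtain ⟨w, hw⟩ : (pullback.fst π b ⁻¹ᵁ offVertex d k π).ι x' ∈ Set.range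
      (vanishingIdeal ⟨(pullback.fst π b) ⁻¹' Z, isClosed_preimage_fst d k π hZ b⟩).subschemeι := by
    rw [range_subschemeι_vanishingIdeal]
    exact hx'Z
  have hw' : reducedPreimageToOffVertex d k π hZ hπZ b w = x' := by
    apply (pullback.fst π b ⁻¹ᵁ offVertex d k π).ι.injective
    rw [← Scheme.Hom.comp_apply, reducedPreimageToOffVertex_ι, hw]
  refine ⟨w, (reducedToOffVertex d k π hZ hπZ).isClosedEmbedding.injective ?_⟩
  rw [← Scheme.Hom.comp_apply, reducedPreimageComparison_fac, Scheme.Hom.comp_apply, hw', hx'φ]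

/-- **`Z'_red ≅ Z_red`**: the comparison is an isomorphism when `φ` is an isomorphism over `X°`
(a surjective closed immersion onto a reduced scheme). [folklore] -/
theorem isIso_reducedPreimageComparison [IsIso (pullback.fst π b ∣_ offVertex d k π)] :
    IsIso (reducedPreimageComparison d k π hZ hπZ b) :=
  haveI := isClosedImmersion_reducedPreimageComparison d k π hZ hπZ (b := b)
  haveI := surjective_reducedPreimageComparison d k π hZ hπZ (b := b)
  isIso_of_isClosedImmersion_of_surjective _

variable {q : P ⟶ Proj (grading (Fin (d + 1)) k)}

/-- **`f|_{Z'} = (Z'_red ≅ Z_red) ≫ (pr ∘ π|_Z)`**: the restriction of `f = pr₂ ≫ q` to the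
reduced preimage `Z'_red` is the comparison followed by `reducedProjection` (de Jong:
"`Z' ≅ Z → π(Z) → ℙ^{d-1}`"). [cite: DeJong1996, Lemma 4.11 (proof), p. 68] -/
theorem vanishingIdeal_subschemeι_comp_fibration (hV : IsVertexProjection d k b q) :
    (vanishingIdeal ⟨(pullback.fst π b) ⁻¹' Z, isClosed_preimage_fst d k π hZ b⟩).subschemeι ≫
        pullback.snd π b ≫ q =
      reducedPreimageComparison d k π hZ hπZ b ≫ reducedProjection d k π hZ hπZ := by
  rw [← reducedPreimageToOffVertex_ι_assoc, preimage_offVertex_ι_comp d k π hV, reducedProjection,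
    ← Category.assoc, ← Category.assoc, reducedPreimageComparison_fac]

end StrictPreimage

/-! ## (ii) c) from generic étaleness of `pr ∘ π|_Z` -/

/-- Generic étaleness is preserved by composing with an isomorphism on the LEFT (no
irreducibility needed, unlike `IsGenericallyEtale.iso_comp`). [folklore] -/
theorem _root_.Literature.AlgebraicGeometry.Resolution.IsGenericallyEtale.precomp
    {T S Y : Scheme.{u}} {g : S ⟶ Y} (hg : IsGenericallyEtale g) (e : T ⟶ S) [IsIso e] :
    IsGenericallyEtale (e ≫ g) := by
  obtain ⟨U, hU, hgU⟩ := hg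
  haveI := hgU
  refine ⟨e ⁻¹ᵁ U, hU.preimage e.isOpenEmbedding.isOpenMap, ?_⟩
  have : (e ⁻¹ᵁ U).ι ≫ e ≫ g = (e ∣_ U) ≫ U.ι ≫ g := by
    rw [← Category.assoc, ← morphismRestrict_ι, Category.assoc]
  rw [this]
  infer_instance

section Conclusion

variable {X : Scheme.{u}} (π : X ⟶ Proj (grading (Fin (d + 1 + 1)) k)) {Z : Set X}
  (hZ : IsClosed Z) (hπZ : vertex d k ∉ π '' Z) {P : Scheme.{u}}
  {b : P ⟶ Proj (grading (Fin (d + 1 + 1)) k)} {q : P ⟶ Proj (grading (Fin (d + 1)) k)}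

/-- **De Jong 1996, Lemma 4.11 (ii) c) from "`Z → π(Z) → ℙ^{d-1}` is generically étale"**: if
`b` is a blowing up of `ℙ^{d+1}` in the vertex, `q` is the projection from the vertex through
`b`, `vertex ∉ π(Z)`, `π` is affine (e.g. finite) and `X` is proper over `k`, then
`f|_{Z'} : Z'_red → ℙ^d` (`Z' = φ⁻¹(Z)`, `f = pr₂ ≫ q`) is finite and generically étale as soon
as `pr ∘ π|_Z : Z_red → ℙ^d` is generically étale. [cite: DeJong1996, Lemma 4.11 (proof), p. 68] -/
theorem isFiniteGenericallyEtaleOn_fibration_of_isGenericallyEtale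
    {h : IsClosed ({vertex d k} : Set (Proj (grading (Fin (d + 1 + 1)) k)))}
    (hb : IsBlowup b (vanishingIdeal ⟨{vertex d k}, h⟩)) (hV : IsVertexProjection d k b q)
    [IsAffineHom π] [IsProper (π ≫ toSpec (Fin (d + 1 + 1)) k)]
    (hgen : IsGenericallyEtale (reducedProjection d k π hZ hπZ)) :
    IsFiniteGenericallyEtaleOn (pullback.snd π b ≫ q) ((pullback.fst π b) ⁻¹' Z) := by
  have eZ' : (⟨closure ((pullback.fst π b) ⁻¹' Z), isClosed_closure⟩ : Closeds ↑(pullback π b)) =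
      ⟨(pullback.fst π b) ⁻¹' Z, isClosed_preimage_fst d k π hZ b⟩ := by
    ext1
    exact (isClosed_preimage_fst d k π hZ b).closure_eq
  unfold IsFiniteGenericallyEtaleOn
  rw [eZ', vanishingIdeal_subschemeι_comp_fibration d k π hZ hπZ hV]
  haveI := isIso_fst_morphismRestrict_offVertex d k π hb
  haveI := isIso_reducedPreimageComparison d k π hZ hπZ (b := b)
  haveI := isFinite_reducedProjection d k π hZ hπZ
  exact ⟨inferInstance, hgen.precomp _⟩

/-- **(ii) c) of `DeJong1996Lemma411VertexChoice` from generic étaleness of `pr ∘ π|_Z`**, keyed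
to the hypothesis structures of that leaf: `π` as in `Lemma411Projection` at the vertex (over
`k`, finite, `vertex ∉ π(Z)`) with `X` proper over `k`, and `(P̃, b, q)` as in
`PointBlowupProjection` + `IsVertexProjection`. [cite: DeJong1996, Lemma 4.11 (proof), p. 68] -/
theorem isFiniteGenericallyEtaleOn_fibration_of_lemma411Projection
    {fX : X ⟶ Spec (.of k)} [IsProper fX] (hZ : IsClosed Z)
    {π : X ⟶ (projectiveSpace (d + 1) k).left}
    (hπ : Lemma411Projection fX Z d π (vertex d k))
    {b : P ⟶ (projectiveSpace (d + 1) k).left} {q : P ⟶ (projectiveSpace d k).left}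
    (hM : PointBlowupProjection d k (vertex d k) b q) (hV : IsVertexProjection d k b q)
    (hgen : IsGenericallyEtale (reducedProjection d k π hZ hπ.notMem_image)) :
    IsFiniteGenericallyEtaleOn (pullback.snd π b ≫ q) ((pullback.fst π b) ⁻¹' Z) := by
  haveI : @IsFinite X (Proj (grading (Fin (d + 1 + 1)) k)) π := hπ.isFinite
  -- the composite typed over `Proj k[x₀, …, x_{d+1}]` (to which `(projectiveSpace _ k).left`
  -- reduces), so that the instance is found below
  haveI : IsProper (CategoryStruct.comp (Y := Proj (grading (Fin (d + 1 + 1)) k)) π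
      (toSpec (Fin (d + 1 + 1)) k)) := by
    have e : CategoryStruct.comp (Y := Proj (grading (Fin (d + 1 + 1)) k)) π
        (toSpec (Fin (d + 1 + 1)) k) = π ≫ (projectiveSpace (d + 1) k).hom := by
      rw [Literature.AlgebraicGeometry.Motives.projectiveSpace_hom_eq_toSpec]
      rfl
    rw [e, hπ.comp_hom]
    infer_instance
  exact isFiniteGenericallyEtaleOn_fibration_of_isGenericallyEtale d k π hZ hπ.notMem_image
    hM.isBlowup hV hgen

end Conclusion

end DeJong1996

end Literature.AlgebraicGeometry.Resolution

end
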